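import Literature.MathematicalPhysics.QuantumLattice.FermionSmearedPauliBound
import HarnessLib

/-!
# Ventures/CertifiedManyBodySolver — Transport/PauliMarkovFourier.lean

HONEST FRAMING: first certified bounds; not a superconductivity verdict; every number certified or labelled float.

Fourier/combinatorial half of LEMMA PM (op-07 TL-FORMULATION §A.6; see `Transport/PauliMarkov.lean` for the
statement, the proof outline and the state-side half): the symbol `p_λ(k) = λ₀ + Σ_{e=1}^{R} 2λ_e cos(ek)` of a
Pauli–Markov one-body row, its Fourier coefficients `pmCoeff`, the exact value
`PM(λ) = (1/2π) ∫₀^{2π} max(p_λ, 0)` (`pmValue`, an interval integral — no numerics), the orthogonality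
relation `∫₀^{2π} e^{imk} dk = 2π[m = 0]` with its consequence `∫₀^{2π} p_λ(k) e^{imk} dk = 2π·pmCoeff(m)`, and
the Fejér pair count `#{(j,l) ∈ [0,W)² : l − j = m} = W − |m|` in the form of the damped-row identity
`W⁻¹ Σ_{j,l<W} F(l − j) = F(0) + Σ_{e=1}^{R} (1 − e/W)(F(e) + F(−e))` for `F` supported in `|m| ≤ R < W`.
Pure real analysis / finite combinatorics (Mathlib: `integral_exp_mul_complex`, `Complex.two_cos`,
`intervalIntegral.integral_finsetSum`, `Finset.sum_comm`, `Nat.card_Ico`); no states, no facts, no sorry.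
-/

noncomputable section

namespace Summit.Ventures.CertifiedManyBodySolver.Transport

open Matrix Finset MeasureTheory intervalIntegral
open Literature.Probability.LatticeModels
open Literature.MathematicalPhysics.QuantumLattice
open scoped ComplexOrder Real

variable {d : ℕ}

/-! ### §1. The symbol `p_λ`, its Fourier coefficients and the value `PM(λ)` -/

/-- The symbol `p_λ(k) = λ₀ + Σ_{e=1}^{R} 2 λ_e cos(e k)` of the one-body row. -/
def pmSymbol (R : ℕ) (lam : ℕ → ℝ) (k : ℝ) : ℝ :=
  lam 0 + ∑ e ∈ Finset.Icc 1 R, 2 * lam e * Real.cos (e * k)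

/-- The Fourier coefficient of `p_λ` at frequency `m ∈ ℤ`: `λ_{|m|}` for `|m| ≤ R`, else `0`. -/
def pmCoeff (R : ℕ) (lam : ℕ → ℝ) (m : ℤ) : ℝ :=
  if m.natAbs ≤ R then lam m.natAbs else 0

/-- `PM(λ) = (1/2π) ∫₀^{2π} max(p_λ(k), 0) dk`. -/
def pmValue (R : ℕ) (lam : ℕ → ℝ) : ℝ :=
  (2 * π)⁻¹ * ∫ k in (0 : ℝ)..2 * π, max (pmSymbol R lam k) 0

/-- `p_λ` is continuous. -/
theorem continuous_pmSymbol (R : ℕ) (lam : ℕ → ℝ) : Continuous (pmSymbol R lam) := by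
  unfold pmSymbol
  fun_prop

/-- `pmCoeff 0 = λ₀`. -/
theorem pmCoeff_zero (R : ℕ) (lam : ℕ → ℝ) : pmCoeff R lam 0 = lam 0 := by
  simp [pmCoeff]

/-- `pmCoeff e = λ_e` for `1 ≤ e ≤ R` (indeed `0 ≤ e ≤ R`). -/
theorem pmCoeff_natCast (R : ℕ) (lam : ℕ → ℝ) {e : ℕ} (he : e ≤ R) : pmCoeff R lam e = lam e := by
  simp [pmCoeff, he]

/-- `pmCoeff` is even in `m`. -/
theorem pmCoeff_neg (R : ℕ) (lam : ℕ → ℝ) (m : ℤ) : pmCoeff R lam (-m) = pmCoeff R lam m := by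
  simp [pmCoeff]

/-- `pmCoeff m = 0` beyond the range `R`. -/
theorem pmCoeff_eq_zero_of_lt (R : ℕ) (lam : ℕ → ℝ) {m : ℤ} (hm : R < m.natAbs) : pmCoeff R lam m = 0 := by
  simp only [pmCoeff, if_neg (not_le.2 hm)]

/-! ### §2. Orthogonality of characters on `[0, 2π]` -/

/-- `∫₀^{2π} e^{imk} dk = 2π [m = 0]` for `m ∈ ℤ`. -/
theorem integral_cexp_int_mul (m : ℤ) :
    ∫ k in (0 : ℝ)..2 * π, Complex.exp (Complex.I * m * k) = if m = 0 then 2 * (π : ℂ) else 0 := by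
  split_ifs with hm
  · simp [hm]
  · have hc : Complex.I * (m : ℂ) ≠ 0 := mul_ne_zero Complex.I_ne_zero (Int.cast_ne_zero.mpr hm)
    have h := integral_exp_mul_complex (a := 0) (b := 2 * π) hc
    simp only [mul_assoc] at h ⊢
    rw [h]
    have h1 : Complex.I * ((m : ℂ) * ((2 * π : ℝ) : ℂ)) = (m : ℂ) * (2 * π * Complex.I) := by
      push_cast; ring
    rw [h1, Complex.exp_int_mul_two_pi_mul_I]
    simp

/-- The symbol as a complex trigonometric polynomial:
`p_λ(k) = λ₀ + Σ_e λ_e (e^{iek} + e^{-iek})`. -/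
theorem pmSymbol_complex (R : ℕ) (lam : ℕ → ℝ) (k : ℝ) :
    (pmSymbol R lam k : ℂ) = lam 0 + ∑ e ∈ Finset.Icc 1 R,
      (lam e : ℂ) * (Complex.exp (Complex.I * (e : ℤ) * k) + Complex.exp (Complex.I * (-(e : ℤ)) * k)) := by
  unfold pmSymbol
  push_cast
  congr 1
  refine Finset.sum_congr rfl fun e _ => ?_
  rw [show (2 : ℂ) * (lam e : ℂ) * Complex.cos ((e : ℂ) * (k : ℂ)) =
    (lam e : ℂ) * (2 * Complex.cos ((e : ℂ) * (k : ℂ))) by ring, Complex.two_cos]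
  congr 1
  congr 1
  · congr 1; ring
  · congr 1; ring

/-- A sum over `e ∈ [1, R]` against the indicator of `(e : ℤ) = m` picks out the term `e = |m|`
exactly when `1 ≤ m ≤ R`. -/
theorem sum_Icc_mul_ite_intCast_eq {β : Type*} [CommRing β] (R : ℕ) (g : ℕ → β) (m : ℤ) (c : β) :
    ∑ e ∈ Finset.Icc 1 R, g e * (if (e : ℤ) = m then c else 0) =
      if 1 ≤ m ∧ m ≤ R then g m.natAbs * c else 0 := by
  by_cases h : 1 ≤ m ∧ m ≤ R
  · rw [if_pos h]
    have hmem : m.natAbs ∈ Finset.Icc 1 R := by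
      rw [Finset.mem_Icc]; omega
    rw [Finset.sum_eq_single_of_mem m.natAbs hmem]
    · rw [if_pos (by omega)]
    · intro e _ hne
      rw [if_neg (by omega), mul_zero]
  · rw [if_neg h]
    refine Finset.sum_eq_zero fun e he => ?_
    rw [Finset.mem_Icc] at he
    rw [if_neg (by omega), mul_zero]

/-- **`∫₀^{2π} p_λ(k) e^{imk} dk = 2π · pmCoeff m`**: the Fourier coefficients of the symbol. -/
theorem integral_pmSymbol_mul_cexp (R : ℕ) (lam : ℕ → ℝ) (m : ℤ) :
    ∫ k in (0 : ℝ)..2 * π, (pmSymbol R lam k : ℂ) * Complex.exp (Complex.I * m * k) =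
      2 * π * (pmCoeff R lam m : ℂ) := by
  have hc : ∀ n : ℤ, Continuous (fun k : ℝ => Complex.exp (Complex.I * n * k)) := fun n => by fun_prop
  have hi : ∀ (n : ℤ) (c : ℂ),
      IntervalIntegrable (fun k : ℝ => c * Complex.exp (Complex.I * n * k)) volume 0 (2 * π) :=
    fun n c => (continuous_const.mul (hc n)).intervalIntegrable _ _
  -- each summand `λ_e (e^{iek} + e^{-iek}) e^{imk} = λ_e e^{i(e+m)k} + λ_e e^{i(m-e)k}`
  have hterm : ∀ (e : ℕ) (k : ℝ), (lam e : ℂ) * (Complex.exp (Complex.I * (e : ℤ) * k) +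
      Complex.exp (Complex.I * (-(e : ℤ)) * k)) * Complex.exp (Complex.I * m * k) =
      (lam e : ℂ) * Complex.exp (Complex.I * ((e : ℤ) + m : ℤ) * k) +
        (lam e : ℂ) * Complex.exp (Complex.I * (-(e : ℤ) + m : ℤ) * k) := by
    intro e k
    rw [mul_assoc, add_mul, ← Complex.exp_add, ← Complex.exp_add, mul_add]
    push_cast
    ring_nf
  simp_rw [pmSymbol_complex, add_mul, Finset.sum_mul, hterm]
  have hi3 : IntervalIntegrable (fun k : ℝ => ∑ e ∈ Finset.Icc 1 R,
      ((lam e : ℂ) * Complex.exp (Complex.I * ((e : ℤ) + m : ℤ) * k) +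
        (lam e : ℂ) * Complex.exp (Complex.I * (-(e : ℤ) + m : ℤ) * k))) volume 0 (2 * π) := by
    apply Continuous.intervalIntegrable
    fun_prop
  rw [intervalIntegral.integral_add (hi m _) hi3, intervalIntegral.integral_const_mul,
    integral_cexp_int_mul, intervalIntegral.integral_finsetSum (fun e _ => (hi _ _).add (hi _ _))]
  simp_rw [intervalIntegral.integral_add (hi _ _) (hi _ _), intervalIntegral.integral_const_mul,
    integral_cexp_int_mul]
  -- evaluate the indicator sums
  have h1 : ∀ e : ℕ, ((e : ℤ) + m = 0) ↔ ((e : ℤ) = -m) := fun e => by omega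
  have h2 : ∀ e : ℕ, (-(e : ℤ) + m = 0) ↔ ((e : ℤ) = m) := fun e => by omega
  simp_rw [h1, h2, Finset.sum_add_distrib, sum_Icc_mul_ite_intCast_eq]
  -- case analysis on `m`
  unfold pmCoeff
  rcases lt_trichotomy m 0 with hneg | rfl | hpos
  · rw [if_neg hneg.ne, mul_zero, zero_add, if_neg (show ¬(1 ≤ m ∧ m ≤ (R : ℤ)) by omega), add_zero]
    by_cases hR : m.natAbs ≤ R
    · rw [if_pos (show 1 ≤ -m ∧ -m ≤ (R : ℤ) by omega), if_pos hR, Int.natAbs_neg]; ring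
    · rw [if_neg (show ¬(1 ≤ -m ∧ -m ≤ (R : ℤ)) by omega), if_neg hR]; simp
  · rw [if_pos rfl, if_neg (show ¬(1 ≤ -(0 : ℤ) ∧ -(0 : ℤ) ≤ (R : ℤ)) by omega),
      if_neg (show ¬(1 ≤ (0 : ℤ) ∧ (0 : ℤ) ≤ (R : ℤ)) by omega), add_zero, add_zero, Int.natAbs_zero,
      if_pos (Nat.zero_le R)]
    ring
  · rw [if_neg hpos.ne', mul_zero, zero_add, if_neg (show ¬(1 ≤ -m ∧ -m ≤ (R : ℤ)) by omega), zero_add]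
    by_cases hR : m.natAbs ≤ R
    · rw [if_pos (show 1 ≤ m ∧ m ≤ (R : ℤ) by omega), if_pos hR]; ring
    · rw [if_neg (show ¬(1 ≤ m ∧ m ≤ (R : ℤ)) by omega), if_neg hR]; simp

/-! ### §4. The pair count `#{(j, l) ∈ [0,W)² : l − j = m} = W − |m|` and the damped row -/

/-- For `j < W` and `m ∈ ℤ`: `Σ_{l<W} [l − j = m] c = [0 ≤ j + m < W] c`. -/
theorem sum_range_ite_sub_eq (W j : ℕ) (m : ℤ) (c : ℝ) :
    ∑ l ∈ Finset.range W, (if ((l : ℤ) - j = m) then c else 0) =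
      if (0 ≤ (j : ℤ) + m ∧ (j : ℤ) + m < W) then c else 0 := by
  by_cases h : 0 ≤ (j : ℤ) + m ∧ (j : ℤ) + m < W
  · rw [if_pos h]
    have hmem : ((j : ℤ) + m).toNat ∈ Finset.range W := by
      rw [Finset.mem_range]; omega
    rw [Finset.sum_eq_single_of_mem _ hmem]
    · rw [if_pos (by omega)]
    · intro l _ hne
      rw [if_neg (by omega)]
  · rw [if_neg h]
    refine Finset.sum_eq_zero fun l hl => ?_
    rw [Finset.mem_range] at hl
    rw [if_neg (by omega)]

/-- `Σ_{j<W} [0 ≤ j + m < W] c = (W − |m|) c`: the number of pairs `(j, l) ∈ [0, W)²` with `l − j = m`. -/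
theorem sum_range_ite_add_mem_eq (W : ℕ) (m : ℤ) (c : ℝ) :
    ∑ j ∈ Finset.range W, (if (0 ≤ (j : ℤ) + m ∧ (j : ℤ) + m < W) then c else 0) =
      ((W - m.natAbs : ℕ) : ℝ) * c := by
  rw [← Finset.sum_filter]
  have hfilter : (Finset.range W).filter (fun j : ℕ => 0 ≤ (j : ℤ) + m ∧ (j : ℤ) + m < W) =
      Finset.Ico ((-m).toNat) (W - m.toNat) := by
    ext j
    simp only [Finset.mem_filter, Finset.mem_range, Finset.mem_Ico]
    omega
  rw [hfilter, Finset.sum_const, Nat.card_Ico, nsmul_eq_mul]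
  congr 2
  omega

/-- `Σ_{m=-R}^{R} Φ(m) = Φ(0) + Σ_{e=1}^{R} (Φ(e) + Φ(−e))`. -/
theorem sum_Icc_neg_eq (R : ℕ) (Φ : ℤ → ℝ) :
    ∑ m ∈ Finset.Icc (-(R : ℤ)) R, Φ m = Φ 0 + ∑ e ∈ Finset.Icc 1 R, (Φ e + Φ (-(e : ℤ))) := by
  have hM' : Finset.Icc (-(R : ℤ)) R = insert (0 : ℤ) ((Finset.Icc 1 R).image (fun e : ℕ => (e : ℤ)) ∪
      (Finset.Icc 1 R).image (fun e : ℕ => -(e : ℤ))) := by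
    ext m
    simp only [Finset.mem_Icc, Finset.mem_insert, Finset.mem_union, Finset.mem_image]
    constructor
    · intro hm
      rcases lt_trichotomy m 0 with h | h | h
      · exact Or.inr (Or.inr ⟨m.natAbs, by omega, by omega⟩)
      · exact Or.inl h
      · exact Or.inr (Or.inl ⟨m.natAbs, by omega, by omega⟩)
    · rintro (rfl | ⟨e, he, rfl⟩ | ⟨e, he, rfl⟩) <;> omega
  have hnotin : (0 : ℤ) ∉ (Finset.Icc 1 R).image (fun e : ℕ => (e : ℤ)) ∪
      (Finset.Icc 1 R).image (fun e : ℕ => -(e : ℤ)) := by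
    simp only [Finset.mem_union, Finset.mem_image, Finset.mem_Icc, not_or, not_exists, not_and]
    constructor <;> intro e he <;> omega
  have hdisj : Disjoint ((Finset.Icc 1 R).image (fun e : ℕ => (e : ℤ)))
      ((Finset.Icc 1 R).image (fun e : ℕ => -(e : ℤ))) := by
    rw [Finset.disjoint_left]
    intro m hm1 hm2
    simp only [Finset.mem_image, Finset.mem_Icc] at hm1 hm2
    obtain ⟨a, ha, rfl⟩ := hm1
    obtain ⟨b, hb, hab⟩ := hm2
    omega
  have hinj1 : Set.InjOn (fun e : ℕ => (e : ℤ)) ↑(Finset.Icc 1 R) := by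
    intro a _ b _ h
    simp only at h
    exact_mod_cast h
  have hinj2 : Set.InjOn (fun e : ℕ => -(e : ℤ)) ↑(Finset.Icc 1 R) := by
    intro a _ b _ h
    simp only [neg_inj] at h
    exact_mod_cast h
  rw [hM', Finset.sum_insert hnotin, Finset.sum_union hdisj, Finset.sum_image hinj1, Finset.sum_image hinj2,
    ← Finset.sum_add_distrib]

/-- **The damped-row identity**: for `F : ℤ → ℝ` supported in `|m| ≤ R` and `W > R`,
`W⁻¹ Σ_{j,l<W} F(l − j) = F(0) + Σ_{e=1}^{R} (1 − e/W)(F(e) + F(−e))` (Fejér weights). -/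
theorem fejer_sum_eq (F : ℤ → ℝ) (R : ℕ) (hF : ∀ m : ℤ, R < m.natAbs → F m = 0) {W : ℕ} (hW : R < W) :
    (W : ℝ)⁻¹ * ∑ j : Fin W, ∑ l : Fin W, F (((l : ℕ) : ℤ) - ((j : ℕ) : ℤ)) =
      F 0 + ∑ e ∈ Finset.Icc 1 R, (1 - (e : ℝ) / W) * (F e + F (-(e : ℤ))) := by
  have hW0 : (0 : ℝ) < W := by exact_mod_cast (Nat.zero_le R).trans_lt hW
  set M : Finset ℤ := Finset.Icc (-(R : ℤ)) R with hM
  -- Step 1: `F(l - j) = Σ_{m ∈ M} [l - j = m] F m`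
  have hstep1 : ∀ j l : ℕ, F ((l : ℤ) - j) = ∑ m ∈ M, if ((l : ℤ) - j = m) then F m else 0 := by
    intro j l
    rw [Finset.sum_ite_eq]
    by_cases hm : ((l : ℤ) - j) ∈ M
    · rw [if_pos hm]
    · rw [if_neg hm, hF]
      simp only [hM, Finset.mem_Icc] at hm
      omega
  -- Step 2: `Fin` sums to `range` sums
  have hconv : ∑ j : Fin W, ∑ l : Fin W, F (((l : ℕ) : ℤ) - ((j : ℕ) : ℤ)) =
      ∑ j ∈ Finset.range W, ∑ l ∈ Finset.range W, F ((l : ℤ) - j) := by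
    rw [← Fin.sum_univ_eq_sum_range]
    refine Finset.sum_congr rfl fun j _ => ?_
    rw [← Fin.sum_univ_eq_sum_range]
  -- Step 3: swap with the `m`-sum and count
  have hswap : ∑ j ∈ Finset.range W, ∑ l ∈ Finset.range W, F ((l : ℤ) - j) =
      ∑ m ∈ M, F m * ((W - m.natAbs : ℕ) : ℝ) := by
    calc ∑ j ∈ Finset.range W, ∑ l ∈ Finset.range W, F ((l : ℤ) - j)
        = ∑ j ∈ Finset.range W, ∑ l ∈ Finset.range W, ∑ m ∈ M, (if ((l : ℤ) - j = m) then F m else 0) := by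
          refine Finset.sum_congr rfl fun j _ => Finset.sum_congr rfl fun l _ => hstep1 j l
      _ = ∑ j ∈ Finset.range W, ∑ m ∈ M, ∑ l ∈ Finset.range W, (if ((l : ℤ) - j = m) then F m else 0) := by
          refine Finset.sum_congr rfl fun j _ => Finset.sum_comm
      _ = ∑ m ∈ M, ∑ j ∈ Finset.range W, ∑ l ∈ Finset.range W, (if ((l : ℤ) - j = m) then F m else 0) :=
          Finset.sum_comm
      _ = ∑ m ∈ M, F m * ((W - m.natAbs : ℕ) : ℝ) := by
          refine Finset.sum_congr rfl fun m _ => ?_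
          simp_rw [sum_range_ite_sub_eq]
          rw [sum_range_ite_add_mem_eq, mul_comm]
  rw [hconv, hswap, Finset.mul_sum, sum_Icc_neg_eq]
  congr 1
  · simp only [Int.natAbs_zero, Nat.sub_zero]
    field_simp
  · refine Finset.sum_congr rfl fun e he => ?_
    rw [Finset.mem_Icc] at he
    have heW : e ≤ W := by omega
    simp only [Int.natAbs_neg, Int.natAbs_natCast]
    rw [Nat.cast_sub heW]
    field_simp

end Summit.Ventures.CertifiedManyBodySolver.Transport

end
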